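import Mathlib
import HarnessLib

/-!
# Fermat cycles — the open instance `(10, 69)`: the singular COORDINATE LINES of the link varieties `B_ab`, `Z_ab` of the cubic door `W₆₉` (kernel record of the combinatorial half of `ftc/certs/W69/ZSING.md`)

HONEST FRAMING: explicit algebraic cycles for specific Hodge classes on Fermat/Delsarte varieties;
residual open instances listed; no claim on general Hodge.

Cell `pub-hfermat`, track FIND-THE-CLASS, seat ftc-engine gen-8; companion of `ftc/certs/W69/ZSING.md` (THEOREM ZS: the exact singular
loci of `B_ab = {Q_a = Q_b = 0} ⊂ ℙ⁸` and `Z_ab = {Q_a = Q_b = 0, Φ_ab + w³ = 0} ⊂ ℙ⁹` — PERIOD `JOIN-W69` §2–3 — for the 22 singular lines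
`L_ab` of `W₆₉ = {Σ_{j ∈ ℤ/11} s_j s_{j+1} s_{j+3} + w³ = 0} ⊂ ℙ¹¹`, whose proof is a certificate: 178 polynomial identities over `ℚ`, two
independent expansions).  Nothing here is cited as a fact; no cycle, class or door word is involved; `(10,69)` stays OPEN.

WHAT IS KERNEL-CHECKED (finite statements, `decide`).  Blocks `T_j = {j, j+1, j+3} ⊂ ℤ/11`; `Q_v = Σ_{T ∋ v} Π_{u ∈ T, u ≠ v} s_u`;
`Φ_ab = Σ_{T ∌ a, b} Π_{u ∈ T} s_u`.  A pair `{p,q}` lies in at most one block, and in one iff `q − p ∈ ±{1,2,3}`; `third p q` is the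
third vertex `u(p,q)` of that block, computed arithmetically (`third_spec` checks it against the block definition `isBlockTriple` on all `11³` triples).
For a coordinate line `ℓ = ⟨e_i, e_j⟩` (`i ≠ j`, both `∉ {a,b}`) and its generic point `(s_i, s_j) = (x, y)` (other coordinates `0`, `w = 0`):
* `ℓ ⊂ B_ab` iff `ℓ ⊂ D_ab := Z_ab ∩ {w = 0}` iff neither `{a,i,j}` nor `{b,i,j}` is a block (`Q_a|_ℓ = [s_is_j ∈ Q_a]·xy`; every
  monomial of `Φ_ab` has three distinct variables, so `Φ_ab|_ℓ = 0`) — this is `onD`;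
* the gradients there are `∇Q_a = x·e_{u(a,i)} + y·e_{u(a,j)}`, `∇Q_b = x·e_{u(b,i)} + y·e_{u(b,j)}`, `∇(Φ_ab + w³) = xy·e_{u(i,j)}`, a
  term being ABSENT when `u` does not exist or is a deleted coordinate `a, b` (the only monomials of `Q_a` through `s_i` are
  `s_i s_{u(a,i)}`; `∂_w(Φ + w³) = 3w² = 0` on `{w = 0}`) — these are `cA`, `cB`, `cC`;
* `ℓ ⊂ Sing B_ab` iff the generic rank of `(∇Q_a, ∇Q_b)` is `≤ 1`; `ℓ × {w=0} ⊂ Sing Z_ab` iff the generic rank of the three gradients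
  is `≤ 2`, i.e. (expanding `3 × 3` minors along the third row, whose only entry is `xy` at `u(i,j)`) iff `u(i,j)` is absent OR all
  `2 × 2` minors of `(∇Q_a, ∇Q_b)` on the columns `≠ u(i,j)` vanish;
* GENERIC RANK MADE FINITE: every entry of `∇Q_a, ∇Q_b` is one of the linear forms `0, x, y, x + y` (encoded as a pair of Booleans),
  and a minor `c₁(v)c₂(w) − c₁(w)c₂(v)` vanishes in `ℤ[x,y]` iff both products are `0` or they have the same multiset of factors
  (`x`, `y`, `x+y` are pairwise non-associate primes of the UFD `ℤ[x,y]`) — this is `mulEq`.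
So `singB a b i j` / `singD a b i j` ARE the statements '`⟨e_i,e_j⟩ ⊂ Sing B_ab`' / '`⟨e_i,e_j⟩ × {w=0} ⊂ Sing Z_ab`' with the geometry
unfolded into combinatorics by the four lines of calculus above, which are the part NOT formalised here.
RESULTS (`decide`): for `(a,b) = (0,4)` [type 4] the singular coordinate lines of `Z₀₄` are EXACTLY the 19 lines of THEOREM ZS (4Z) and
those of `B₀₄` exactly `[5,6],[6,7],[8,10],[9,10]`; for `(0,5)` [type 5] exactly the 21 lines of (5Z)/(5D) and the 6 lines
`[1,9],[1,10],[9,10]` (inside the plane `V = vertex Q₅`) `∪ [4,6],[6,7],[6,9]`; for ALL 22 pairs the counts are `(4, 19)` (type 4) /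
`(6, 21)` (type 5); and in both types the `Z`-singular lines that are NOT projections of singular lines `L_cd` of `W₆₉`
(`d − c ∈ ±{4,5}`) are exactly the `B`-singular ones (19 = 15 + 4; 21 = 15 + 6).  Two numeric derivations in the cell files agree with
these lists (`code/ftc/zsing/discover.py`: Jacobian rank at random torus points mod 32003; `line_rule.py`: rank over `ℚ(x,y)` by
evaluation) — this file is the third, by case logic alone.
NOT here: the non-linear components (the conic `Γ`, the cubic surface `S`), the absence of further components, the transversal types —
those are ZSING's certificate, not kernel statements.
-/

namespace Summit.HodgeConjecture.FermatCycles.ZabSingularLines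

/-- `isBlockTriple p q k`: `(p, q, k)` is an ordering of a block `T_j = {j, j+1, j+3} ⊂ ℤ/11` of the cyclic cubic `Σ s_j s_{j+1} s_{j+3}`
(indices as `Fin 11`, arithmetic mod 11; Boolean-valued). -/
def isBlockTriple (p q k : Fin 11) : Bool :=
  decide (∃ j : Fin 11, (p = j ∧ q = j + 1 ∧ k = j + 3) ∨ (p = j ∧ q = j + 3 ∧ k = j + 1) ∨ (p = j + 1 ∧ q = j ∧ k = j + 3) ∨
    (p = j + 1 ∧ q = j + 3 ∧ k = j) ∨ (p = j + 3 ∧ q = j ∧ k = j + 1) ∨ (p = j + 3 ∧ q = j + 1 ∧ k = j))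

/-- `third p q`: the third vertex `u(p,q)` of the unique block containing `{p,q}`, read off the difference `q − p ∈ {±1, ±2, ±3}`
(`(j,j+1) ↦ j+3`, `(j,j+3) ↦ j+1`, `(j+1,j+3) ↦ j`); `none` if `{p,q}` lies in no block. -/
def third (p q : Fin 11) : Option (Fin 11) :=
  match (q - p).val with
  | 1 => some (p + 3)
  | 10 => some (p + 2)
  | 3 => some (p + 1)
  | 8 => some (p + 9)
  | 2 => some (p + 10)
  | 9 => some (p + 8)
  | _ => none

/-- `third` agrees with the block definition: `third p q = some k` iff `{p, q, k}` is a block (in some order); in particular a pair lies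
in at most one block, and the elements of a block are pairwise distinct (both decided here over all `11³` triples). -/
theorem third_spec : ∀ p q k : Fin 11,
    (third p q = some k ↔ isBlockTriple p q k = true) ∧ (isBlockTriple p q k = true → p ≠ q ∧ q ≠ k ∧ p ≠ k) := by
  decide +kernel

/-- `inBlock p q k`: `k = u(p,q)`. -/
def inBlock (p q k : Fin 11) : Bool := third p q == some k

/-- A linear form `bx·x + by·y` with `0/1` coefficients, encoded as the pair `(bx, by)`; `(false, false)` is the zero form. -/
abbrev LF := Bool × Bool

/-- `mulEq p q r s`: the identity `p·q = r·s` holds in `ℤ[x,y]` for the encoded linear forms (both sides zero, or the same multiset of the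
pairwise non-associate prime factors `x`, `y`, `x + y`). -/
def mulEq (p q r s : LF) : Bool :=
  let z : LF → Bool := fun c => c == (false, false)
  ((z p || z q) && (z r || z s)) || (!(z p) && !(z q) && !(z r) && !(z s) && ((p == r && q == s) || (p == s && q == r)))

/-- The entry of `∇Q_a` at the coordinate `v` on the generic point `(s_i, s_j) = (x, y)` of `⟨e_i, e_j⟩` (coordinates `a, b` deleted):
`x` if `v = u(a,i)`, `y` if `v = u(a,j)`. -/
def cA (a b i j v : Fin 11) : LF := (inBlock a i v && decide (v ≠ b), inBlock a j v && decide (v ≠ b))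

/-- The entry of `∇Q_b` at the coordinate `v` (same conventions, `a` deleted). -/
def cB (a b i j v : Fin 11) : LF := (inBlock b i v && decide (v ≠ a), inBlock b j v && decide (v ≠ a))

/-- `cC a b i j v`: the coordinate `v` carries the only entry `xy` of `∇Φ_ab`, i.e. `v = u(i,j)` and `v ∉ {a, b}`. -/
def cC (a b i j v : Fin 11) : Bool := inBlock i j v && decide (v ≠ a ∧ v ≠ b)

/-- `isCol a b v`: `v` is a coordinate of `ℙ⁸ ⊃ B_ab`, i.e. `v ∉ {a, b}`. -/
def isCol (a b v : Fin 11) : Bool := decide (v ≠ a ∧ v ≠ b)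

/-- `rankLe1 a b i j keep`: every `2 × 2` minor of `(∇Q_a, ∇Q_b)` on the columns `v, w` with `keep v`, `keep w` vanishes identically
(generic rank `≤ 1` on those columns). -/
def rankLe1 (a b i j : Fin 11) (keep : Fin 11 → Bool) : Bool :=
  decide (∀ v w : Fin 11, keep v = true → keep w = true → mulEq (cA a b i j v) (cB a b i j w) (cA a b i j w) (cB a b i j v) = true)

/-- `onD a b i j`: `⟨e_i, e_j⟩` is a coordinate line of `ℙ⁸` (indices distinct, `∉ {a,b}`) lying on `B_ab` (equivalently on `D_ab`): neither
`{a,i,j}` nor `{b,i,j}` is a block. -/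
def onD (a b i j : Fin 11) : Bool :=
  decide (i ≠ j ∧ i ≠ a ∧ i ≠ b ∧ j ≠ a ∧ j ≠ b) && !(inBlock a i j) && !(inBlock b i j)

/-- `singB a b i j`: the line `⟨e_i, e_j⟩` lies in `Sing B_ab`. -/
def singB (a b i j : Fin 11) : Bool := onD a b i j && rankLe1 a b i j (isCol a b)

/-- `singD a b i j`: the line `⟨e_i, e_j⟩ × {w = 0}` lies in `Sing Z_ab`: either `∇Φ_ab` vanishes on the line (no admissible `u(i,j)`) or the
`2 × 2` minors of `(∇Q_a, ∇Q_b)` off the column `u(i,j)` all vanish. -/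
def singD (a b i j : Fin 11) : Bool :=
  onD a b i j &&
    (decide (∀ c : Fin 11, isCol a b c = true → cC a b i j c = false) ||
      rankLe1 a b i j (fun v => isCol a b v && !(cC a b i j v)))

/-- All index pairs `(i, j)` with `i < j` (as a list of pairs in `Fin 11`). -/
def allPairs : List (Fin 11 × Fin 11) :=
  ((List.finRange 11).product (List.finRange 11)).filter fun p => p.1 < p.2

/-- The singular coordinate lines of `Z_ab`, as pairs of naturals `(i, j)`, `i < j`. -/
def linesD (a b : Fin 11) : List (ℕ × ℕ) :=
  (allPairs.filter fun p => singD a b p.1 p.2).map fun p => (p.1.val, p.2.val)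

/-- The singular coordinate lines of `B_ab`. -/
def linesB (a b : Fin 11) : List (ℕ × ℕ) :=
  (allPairs.filter fun p => singB a b p.1 p.2).map fun p => (p.1.val, p.2.val)

/-- `isProjection (i,j)`: `j − i ∈ ±{4,5} (mod 11)`, i.e. `⟨e_i, e_j⟩` is the image of a singular line `L_ij` of `W₆₉` under the projection from `L_ab`. -/
def isProjection (p : ℕ × ℕ) : Bool := decide ((p.2 + 11 - p.1) % 11 ∈ [4, 5, 6, 7])

/-- TYPE 4, `(a,b) = (0,4)`: the singular coordinate lines of `Z₀₄` are exactly the 19 lines of ZSING THEOREM ZS (4Z). -/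
theorem linesD_04 : linesD 0 4 = [(1,5), (1,6), (1,7), (1,8), (2,6), (2,7), (2,8), (2,9), (3,7), (3,8), (3,9), (3,10),
    (5,6), (5,9), (5,10), (6,7), (6,10), (8,10), (9,10)] := by
  decide +kernel

/-- TYPE 4: the singular coordinate lines of `B₀₄` are exactly `[5,6], [6,7], [8,10], [9,10]`. -/
theorem linesB_04 : linesB 0 4 = [(5,6), (6,7), (8,10), (9,10)] := by
  decide +kernel

/-- TYPE 5, `(a,b) = (0,5)`: the singular coordinate lines of `Z₀₅` (all inside `{w = 0}`) are exactly the 21 lines of ZSING (5Z)/(5D)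
(18 irreducible components of `Sing Z₀₅` and the 3 lines `[1,9], [1,10], [9,10]` of `S ∩ {w = 0}`). -/
theorem linesD_05 : linesD 0 5 = [(1,6), (1,7), (1,8), (1,9), (1,10), (2,6), (2,7), (2,8), (2,9), (3,7), (3,8), (3,9), (3,10),
    (4,6), (4,8), (4,9), (4,10), (6,7), (6,9), (6,10), (9,10)] := by
  decide +kernel

/-- TYPE 5: the singular coordinate lines of `B₀₅` are exactly the three lines of the plane `V = ⟨e₁, e₉, e₁₀⟩` and `[4,6], [6,7], [6,9]`. -/
theorem linesB_05 : linesB 0 5 = [(1,9), (1,10), (4,6), (6,7), (6,9), (9,10)] := by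
  decide +kernel

/-- In both types the `Z`-singular coordinate lines that are NOT projections of singular lines of `W₆₉` are exactly the `B`-singular ones,
and exactly 15 projections occur. -/
theorem nonProjection_eq_linesB :
    (linesD 0 4).filter (fun p => !(isProjection p)) = linesB 0 4 ∧ ((linesD 0 4).filter isProjection).length = 15 ∧
    (linesD 0 5).filter (fun p => !(isProjection p)) = linesB 0 5 ∧ ((linesD 0 5).filter isProjection).length = 15 := by
  refine ⟨?_, ?_, ?_, ?_⟩ <;> decide +kernel

set_option maxRecDepth 100000 in set_option maxHeartbeats 8000000 in
/-- ALL 22 PAIRS (the shift `j ↦ j + a` is a symmetry of the block system; here the counts are checked outright): every type-4 pair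
`(a, a+4)` has exactly 4 singular coordinate lines on `B` and 19 on `Z`; every type-5 pair `(a, a+5)` has 6 and 21. -/
theorem counts_all_pairs : ∀ a : Fin 11,
    (linesB a (a + 4)).length = 4 ∧ (linesD a (a + 4)).length = 19 ∧
    (linesB a (a + 5)).length = 6 ∧ (linesD a (a + 5)).length = 21 := by
  decide +kernel

end Summit.HodgeConjecture.FermatCycles.ZabSingularLines
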